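import Summits.QuantumFields.YangMills.Theorems.EguchiKawaiDirectionLadderReducedAction
import Summits.Ventures.YMGap.Thresholds.LatticeBakryEmeryPoincare
import Summits.Ventures.YMGap.Thresholds.WilsonHessian
import HarnessLib

/-!
# The Eguchi–Kawai reduced action on `SU(N)^d`: Hessian bound and the Bakry–Émery Poincaré
# inequality at strong coupling

HONEST FRAMING. Glue for LINE 8 (`route-QuantumFields-EguchiKawaiDirectionLadder`, barrier-ledger line
onto `Literature.Barriers.QuantumFields.EguchiKawaiBreakdown`), serving the STRONG-COUPLING companion of
the proved breakdown: evasion (d) of the barrier entry («no such breaking occurs within the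
strong-coupling expansion», Makeenko 2023 §14.3, p. 246) as a theorem about the single-site integral —
at small inverse 't Hooft coupling `|b|` the `SU(N)` Eguchi–Kawai measure satisfies an `N`-UNIFORM
Poincaré inequality with Bakry–Émery constant `N/2 - 8(d-1)N|b| = (N/2)(1 - 16(d-1)|b|)`. Nothing here
concerns the Yang–Mills mass gap / the summit Statement `YangMills`.

Second half of the ADAPTER to the tree's kernel-checked **multi-link Bakry–Émery Poincaré inequality
on `SU(N)^E` for polynomial potentials** (`Summit.Ventures.YMGap.LatticeBakryEmery.poincare_gibbs_lipschitz`):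

* `abs_word2_le` : two-sided single-plaquette bound `|word2 V B| ≤ 4 Σ_k ‖V_k‖²` for unitary `B_k`
  (upper sign = the venture's `word2_le_cornerSq`, lower sign by `V ↦ iV`);
* `algD_algD_ekPlaq` : along the right flow `g e^{sV}` a reduced plaquette `Re tr(V_νᴴ V_μᴴ V_ν V_μ)`
  is the exponential word `Re tr(e^{-sV_ν} g_νᴴ e^{-sV_μ} (g_μᴴ g_ν) e^{sV_ν} g_μ e^{sV_μ})` of
  `ExpWordCalculus`, so `D_V D_V ekPlaq = word2 (…)`, whence `|D_V D_V ekPlaq| ≤ 8(‖V_μ‖_F² + ‖V_ν‖_F²)`;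
* `hessBound_ekPot` : `HessBound (ekPot d N b) (8 (d-1) N |b|)`; `ekCurvature_pos` : the constant
  `N/2 - 8(d-1)N|b|` is positive for all `N ≥ 1` once `16(d-1)|b| < 1`;
* `ek_poincare_re / ek_poincare_im` : for every `d`, `N ≥ 1`, `μ`, `16(d-1)|b| < 1`:
  `(N/2 - 8(d-1)N|b|) ∫ w (u - m)² ≤ (1/N) ∫ w` over `ekHaarSU d N`, `w = ekWeight N b ∘ inclSU`,
  `u = Re/Im openLine μ ∘ inclSU`, `m` its `w`-mean — i.e. `Var ≤ 2/(N²(1 - 16(d-1)|b|))`.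

With the exact centre symmetry `ekExpectationSU_openLine_re/im = 0` (`N ≥ 2`,
`EguchiKawaiBreakdownSpecialUnitaryCentre.lean`) the mean `m` vanishes, and `ekOrderParameterSU_eq`
transfers to `U(N)`: this yields `EKOpenLinesVanish d b` for `16(d-1)|b| < 1` (the application file).

References: D. Bakry, M. Émery, LNM 1123 (1985); H. Shen, R. Zhu, X. Zhu, CMP 400 (2023) 805, Lemma 4.1,
Thm 4.2 (the lattice instance — its printed threshold `1/(16(d-1))` reappears here for the single-site
model); Y. Makeenko, *Methods of Contemporary Gauge Theory* (2023) §14.3.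
-/


noncomputable section

open scoped Matrix ComplexConjugate BigOperators Matrix.Norms.Frobenius ContDiff Topology
open Matrix Complex Finset MeasureTheory Filter
open Summit.Ventures.YMGap.LatticeBakryEmery
open Summit.Ventures.YMGap.HessianSharp (word2 reTrWord expWord word2_le_cornerSq conjTranspose_mul_self_of_mem
  mul_conjTranspose_self_of_mem iteratedDeriv_two_reTrWord conjTranspose_exp_smul_of_skew)
open Summit.Ventures.YMGap
open Literature.MathematicalPhysics.QuantumFieldTheory (frobNorm frobNorm_nonneg frobNorm_sq_eq_re_trace
  frobNorm_smul suFrobDist haarProbability)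
open Literature.Barriers.QuantumFields (EKConfigSU ekHaarSU inclSU ekWeight ekAction ekPlaqTrace openLine
  coe_inclSU_apply)

namespace Summit.QuantumFields.YangMills.Theorems.EguchiKawaiDirectionLadder

variable {d N : ℕ}

/-! ## The second-order word: a two-sided bound -/

section Word

variable {n : Type*} [Fintype n]

/-- `‖A‖² = Re tr(A Aᴴ)` is the square of the Frobenius norm `‖A‖_F`. -/
theorem frobSq_eq_frobNorm_sq (A : Matrix n n ℂ) : HessianSharp.frobSq A = frobNorm A ^ 2 := by
  rw [HessianSharp.frobSq, frobNorm_sq_eq_re_trace, Matrix.trace_mul_comm]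

/-- `‖A + B‖² ≤ 2‖A‖² + 2‖B‖²`. -/
theorem frobSq_add_le (A B : Matrix n n ℂ) : HessianSharp.frobSq (A + B) ≤ 2 * HessianSharp.frobSq A + 2 * HessianSharp.frobSq B := by
  have h1 := HessianSharp.frobSq_add A B
  have h2 := HessianSharp.frobSq_sub A B
  have h3 := HessianSharp.frobSq_nonneg (A - B)
  linarith

/-- `‖i A‖² = ‖A‖²`. -/
theorem frobSq_I_smul (A : Matrix n n ℂ) : HessianSharp.frobSq (I • A) = HessianSharp.frobSq A := by
  rw [frobSq_eq_frobNorm_sq, frobSq_eq_frobNorm_sq, frobNorm_smul, Complex.norm_I, one_mul]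

/-- The second-order word is a quadratic form in the directions: `word2 (iV) B = - word2 V B`. -/
theorem word2_I_smul (V₁ B₁ V₂ B₂ V₃ B₃ V₄ B₄ : Matrix n n ℂ) :
    word2 (I • V₁) B₁ (I • V₂) B₂ (I • V₃) B₃ (I • V₄) B₄ = -word2 V₁ B₁ V₂ B₂ V₃ B₃ V₄ B₄ := by
  have hI : ∀ z : ℂ, I * (I * z) = -z := fun z => by rw [← mul_assoc, Complex.I_mul_I, neg_one_mul]
  simp only [word2, Matrix.smul_mul, Matrix.mul_smul, Matrix.trace_smul, smul_eq_mul, hI]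
  simp only [Complex.neg_re, Complex.add_re, Complex.mul_re, Complex.re_ofNat, Complex.im_ofNat,
    Complex.neg_im, Complex.add_im, zero_mul, sub_zero]
  ring

/-- **Two-sided single-plaquette bound.** For unitary `B₁..B₄` and arbitrary `V₁..V₄`:
`|word2 V B| ≤ 4 (‖V₁‖² + ‖V₂‖² + ‖V₃‖² + ‖V₄‖²)` — the upper bound is the single-plaquette lemma
`word2_le_cornerSq` with `‖V_k + B_k V_{k+1} B_kᴴ‖² ≤ 2‖V_k‖² + 2‖V_{k+1}‖²`, the lower bound is the
upper bound for `iV`. -/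
theorem abs_word2_le [DecidableEq n] (V₁ B₁ V₂ B₂ V₃ B₃ V₄ B₄ : Matrix n n ℂ)
    (hB₁ : B₁ ∈ Matrix.unitaryGroup n ℂ) (hB₂ : B₂ ∈ Matrix.unitaryGroup n ℂ)
    (hB₃ : B₃ ∈ Matrix.unitaryGroup n ℂ) (hB₄ : B₄ ∈ Matrix.unitaryGroup n ℂ) :
    |word2 V₁ B₁ V₂ B₂ V₃ B₃ V₄ B₄| ≤ 4 * (HessianSharp.frobSq V₁ + HessianSharp.frobSq V₂ + HessianSharp.frobSq V₃ + HessianSharp.frobSq V₄) := by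
  -- the upper bound, for arbitrary directions
  have hup : ∀ W₁ W₂ W₃ W₄ : Matrix n n ℂ,
      word2 W₁ B₁ W₂ B₂ W₃ B₃ W₄ B₄ ≤ 4 * (HessianSharp.frobSq W₁ + HessianSharp.frobSq W₂ + HessianSharp.frobSq W₃ + HessianSharp.frobSq W₄) := by
    intro W₁ W₂ W₃ W₄
    have h := word2_le_cornerSq W₁ B₁ W₂ B₂ W₃ B₃ W₄ B₄ hB₁ hB₂ hB₃ hB₄
    have c₁ := frobSq_add_le W₁ (B₁ * W₂ * B₁ᴴ)
    have c₂ := frobSq_add_le W₂ (B₂ * W₃ * B₂ᴴ)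
    have c₃ := frobSq_add_le W₃ (B₃ * W₄ * B₃ᴴ)
    have c₄ := frobSq_add_le W₄ (B₄ * W₁ * B₄ᴴ)
    rw [HessianSharp.frobSq_conj _ _ (conjTranspose_mul_self_of_mem hB₁)] at c₁
    rw [HessianSharp.frobSq_conj _ _ (conjTranspose_mul_self_of_mem hB₂)] at c₂
    rw [HessianSharp.frobSq_conj _ _ (conjTranspose_mul_self_of_mem hB₃)] at c₃
    rw [HessianSharp.frobSq_conj _ _ (conjTranspose_mul_self_of_mem hB₄)] at c₄
    linarith
  have h1 := hup V₁ V₂ V₃ V₄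
  have h2 := hup (I • V₁) (I • V₂) (I • V₃) (I • V₄)
  rw [word2_I_smul, frobSq_I_smul, frobSq_I_smul, frobSq_I_smul, frobSq_I_smul] at h2
  rw [abs_le]
  constructor <;> linarith

end Word

/-! ## The Hessian of one reduced plaquette along the right flow -/

/-- Components of the right flow `emb g · e^{sV}` in the product algebra. -/
theorem emb_mul_exp_apply (g : PSU (Fin d) N) (V : Cfg (Fin d) N) (s : ℝ) (e : Fin d) :
    (emb g * NormedSpace.exp (s • V)) e = (g e : Matrix (Fin N) (Fin N) ℂ) * NormedSpace.exp (s • V e) := by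
  rw [Pi.mul_apply, show NormedSpace.exp (s • V) = fun e => NormedSpace.exp ((s • V) e) from Pi.exp_def _]
  simp only [Pi.smul_apply, emb_apply]

/-- **Along the right flow a reduced plaquette is an exponential word**:
`Re tr((g_ν e^{sV_ν})ᴴ (g_μ e^{sV_μ})ᴴ g_ν e^{sV_ν} g_μ e^{sV_μ})
  = Re tr(e^{-sV_ν} g_νᴴ e^{-sV_μ} (g_μᴴ g_ν) e^{sV_ν} g_μ e^{sV_μ})` for skew-Hermitian `V`. -/
theorem ekPlaq_flow (μ ν : Fin d) (g : PSU (Fin d) N) {V : Cfg (Fin d) N} (hV : ∀ e, (V e)ᴴ = -V e) :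
    (fun s : ℝ => ekPlaq μ ν (emb g * NormedSpace.exp (s • V))) =
      reTrWord 1 (-V ν) (g ν : Matrix (Fin N) (Fin N) ℂ)ᴴ (-V μ)
        ((g μ : Matrix (Fin N) (Fin N) ℂ)ᴴ * (g ν : Matrix (Fin N) (Fin N) ℂ)) (V ν)
        (g μ : Matrix (Fin N) (Fin N) ℂ) (V μ) 1 := by
  funext s
  simp only [ekPlaq, reTrWord, expWord, emb_mul_exp_apply, Matrix.conjTranspose_mul,
    conjTranspose_exp_smul_of_skew (hV _), Matrix.one_mul, Matrix.mul_one, Matrix.mul_assoc]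

/-- **`D_V D_V` of a reduced plaquette at `SU(N)^d` is the second-order word `word2`.** -/
theorem algD_algD_ekPlaq (μ ν : Fin d) (g : PSU (Fin d) N) {V : Cfg (Fin d) N} (hV : ∀ e, (V e)ᴴ = -V e) :
    algD V (algD V (ekPlaq μ ν)) (emb g) =
      word2 (-V ν) (g ν : Matrix (Fin N) (Fin N) ℂ)ᴴ (-V μ)
        ((g μ : Matrix (Fin N) (Fin N) ℂ)ᴴ * (g ν : Matrix (Fin N) (Fin N) ℂ)) (V ν)
        (g μ : Matrix (Fin N) (Fin N) ℂ) (V μ) 1 := by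
  rw [← iteratedDeriv_two_emb_mul_exp (contDiff_ekPlaq μ ν) g V, ekPlaq_flow μ ν g hV,
    iteratedDeriv_two_reTrWord]

/-- **Hessian of one reduced plaquette**: `|D_V D_V Re tr(Q_νᴴ Q_μᴴ Q_ν Q_μ)| ≤ 8(‖V_μ‖_F² + ‖V_ν‖_F²)`
at every `Q ∈ SU(N)^d`, for `V ∈ 𝔲(N)^d`. -/
theorem abs_algD_algD_ekPlaq_le (μ ν : Fin d) (g : PSU (Fin d) N) {V : Cfg (Fin d) N}
    (hV : ∀ e, (V e)ᴴ = -V e) :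
    |algD V (algD V (ekPlaq μ ν)) (emb g)| ≤ 8 * (frobNorm (V μ) ^ 2 + frobNorm (V ν) ^ 2) := by
  rw [algD_algD_ekPlaq μ ν g hV]
  have hμ : (g μ : Matrix (Fin N) (Fin N) ℂ) ∈ Matrix.unitaryGroup (Fin N) ℂ := emb_mem_unitaryGroup g μ
  have hν : (g ν : Matrix (Fin N) (Fin N) ℂ) ∈ Matrix.unitaryGroup (Fin N) ℂ := emb_mem_unitaryGroup g ν
  have hνH : (g ν : Matrix (Fin N) (Fin N) ℂ)ᴴ ∈ Matrix.unitaryGroup (Fin N) ℂ := by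
    rw [← Matrix.star_eq_conjTranspose]; exact Unitary.star_mem hν
  have hμH : (g μ : Matrix (Fin N) (Fin N) ℂ)ᴴ ∈ Matrix.unitaryGroup (Fin N) ℂ := by
    rw [← Matrix.star_eq_conjTranspose]; exact Unitary.star_mem hμ
  have h2 : (g μ : Matrix (Fin N) (Fin N) ℂ)ᴴ * (g ν : Matrix (Fin N) (Fin N) ℂ) ∈
      Matrix.unitaryGroup (Fin N) ℂ := Submonoid.mul_mem _ hμH hν
  have h1 : (1 : Matrix (Fin N) (Fin N) ℂ) ∈ Matrix.unitaryGroup (Fin N) ℂ := Submonoid.one_mem _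
  have h := abs_word2_le (-V ν) _ (-V μ) _ (V ν) _ (V μ) _ hνH h2 hμ h1
  rw [HessianSharp.frobSq_neg, HessianSharp.frobSq_neg, frobSq_eq_frobNorm_sq, frobSq_eq_frobNorm_sq] at h
  linarith

/-! ## The Hessian of the potential -/

/-- `D_V ekTerm μ ν = [μ ≠ ν] · (-(1/2N)) D_V ekPlaq μ ν`. -/
theorem algD_ekTerm (μ ν : Fin d) (V : Cfg (Fin d) N) :
    algD V (ekTerm (N := N) μ ν) = fun Q => if μ = ν then 0 else -(1 / (2 * (N : ℝ))) * algD V (ekPlaq μ ν) Q := by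
  by_cases h : μ = ν
  · have : ekTerm (N := N) μ ν = fun _ => (0 : ℝ) := by funext Q; simp [ekTerm, h]
    rw [this, algD_const]
    funext Q; simp [h]
  · have : ekTerm (N := N) μ ν = fun Q => (1 / 2 : ℝ) + (-(1 / (2 * (N : ℝ))) * ekPlaq μ ν Q) := by
      funext Q; simp only [ekTerm, h, if_false]; ring
    have hc : ContDiff ℝ ∞ fun Q : Cfg (Fin d) N => -(1 / (2 * (N : ℝ))) * ekPlaq μ ν Q :=
      contDiff_const.mul (contDiff_ekPlaq μ ν)
    rw [this, algD_fun_add contDiff_const hc, algD_const, algD_const_mul (contDiff_ekPlaq μ ν)]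
    funext Q; simp [h]

/-- `D_V D_V ekTerm μ ν = [μ ≠ ν] · (-(1/2N)) D_V D_V ekPlaq μ ν`. -/
theorem algD_algD_ekTerm (μ ν : Fin d) (V : Cfg (Fin d) N) :
    algD V (algD V (ekTerm (N := N) μ ν)) =
      fun Q => if μ = ν then 0 else -(1 / (2 * (N : ℝ))) * algD V (algD V (ekPlaq μ ν)) Q := by
  rw [algD_ekTerm]
  by_cases h : μ = ν
  · simp only [h, if_true]
    exact algD_const 0 V
  · simp only [h, if_false]
    exact algD_const_mul (contDiff_algD (contDiff_ekPlaq μ ν) V) _ V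

/-- `D_V (Σ_μ Σ_ν F μ ν) = Σ_μ Σ_ν D_V (F μ ν)` for smooth summands. -/
theorem algD_sum_sum {F : Fin d → Fin d → Cfg (Fin d) N → ℝ} (hF : ∀ μ ν, ContDiff ℝ ∞ (F μ ν))
    (V : Cfg (Fin d) N) :
    algD V (fun Q => ∑ μ : Fin d, ∑ ν : Fin d, F μ ν Q) = fun Q => ∑ μ : Fin d, ∑ ν : Fin d, algD V (F μ ν) Q := by
  have h := algD_sum Finset.univ (F := fun μ => fun Q : Cfg (Fin d) N => ∑ ν : Fin d, F μ ν Q)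
    (fun μ _ => ContDiff.sum fun ν _ => hF μ ν) V
  refine h.trans ?_
  funext Q
  refine Finset.sum_congr rfl fun μ _ => ?_
  rw [algD_sum _ (fun ν _ => hF μ ν)]

/-- `D_V D_V ekPot = -N²b · Σ_μ Σ_ν D_V D_V ekTerm μ ν`. -/
theorem algD_algD_ekPot (b : ℝ) (V : Cfg (Fin d) N) (Q : Cfg (Fin d) N) :
    algD V (algD V (ekPot d N b)) Q =
      -((N : ℝ) ^ 2 * b) * ∑ μ : Fin d, ∑ ν : Fin d, algD V (algD V (ekTerm μ ν)) Q := by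
  have hT : ∀ μ ν : Fin d, ContDiff ℝ ∞ (ekTerm (N := N) μ ν) := fun μ ν => contDiff_ekTerm μ ν
  have hS : ContDiff ℝ ∞ fun Q : Cfg (Fin d) N => ∑ μ : Fin d, ∑ ν : Fin d, ekTerm μ ν Q :=
    ContDiff.sum fun μ _ => ContDiff.sum fun ν _ => hT μ ν
  have h1 : algD V (ekPot d N b) =
      fun Q => -((N : ℝ) ^ 2 * b) * ∑ μ : Fin d, ∑ ν : Fin d, algD V (ekTerm μ ν) Q := by
    rw [ekPot_eq, algD_const_mul hS, algD_sum_sum hT]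
  have hS' : ContDiff ℝ ∞ fun Q : Cfg (Fin d) N => ∑ μ : Fin d, ∑ ν : Fin d, algD V (ekTerm μ ν) Q :=
    ContDiff.sum fun μ _ => ContDiff.sum fun ν _ => contDiff_algD (hT μ ν) V
  rw [h1, algD_const_mul hS', algD_sum_sum (fun μ ν => contDiff_algD (hT μ ν) V)]

/-- Off-diagonal pair counting: `Σ_μ Σ_{ν ≠ μ} (a_μ + a_ν) = 2(d-1) Σ a`. -/
theorem sum_sum_ite_add (a : Fin d → ℝ) :
    ∑ μ : Fin d, ∑ ν : Fin d, (if μ = ν then 0 else a μ + a ν) = 2 * ((d : ℝ) - 1) * ∑ e, a e := by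
  have h : ∀ μ ν : Fin d, (if μ = ν then (0 : ℝ) else a μ + a ν) = (a μ + a ν) - if μ = ν then a μ + a ν else 0 := by
    intro μ ν; split_ifs <;> ring
  simp only [h, Finset.sum_sub_distrib, Finset.sum_ite_eq, Finset.mem_univ, if_true, Finset.sum_add_distrib,
    Finset.sum_const, Finset.card_univ, Fintype.card_fin, nsmul_eq_mul, ← Finset.mul_sum]
  ring

/-- **The Hessian hypothesis of the multi-link Bakry–Émery theorem for the Eguchi–Kawai potential**:
`|D_V D_V ekPot (Q)| ≤ 8 (d-1) N |b| Σ_μ ‖V_μ‖_F²` for `Q ∈ SU(N)^d`, `V ∈ 𝔰𝔲(N)^d`. -/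
theorem hessBound_ekPot (hN : N ≠ 0) (b : ℝ) :
    HessBound (ekPot d N b) (8 * ((d : ℝ) - 1) * N * |b|) := by
  intro g V hV _hV0
  rw [algD_algD_ekPot]
  simp only [algD_algD_ekTerm]
  have hNr : (0 : ℝ) < N := by exact_mod_cast Nat.pos_of_ne_zero hN
  -- termwise bound
  have hterm : ∀ μ ν : Fin d,
      |(if μ = ν then (0 : ℝ) else -(1 / (2 * (N : ℝ))) * algD V (algD V (ekPlaq μ ν)) (emb g))| ≤
        (1 / (2 * (N : ℝ))) * (if μ = ν then (0 : ℝ) else 8 * (frobNorm (V μ) ^ 2 + frobNorm (V ν) ^ 2)) := by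
    intro μ ν
    split_ifs
    · simp
    · rw [abs_mul, abs_neg, abs_of_pos (by positivity : (0 : ℝ) < 1 / (2 * (N : ℝ)))]
      exact mul_le_mul_of_nonneg_left (abs_algD_algD_ekPlaq_le μ ν g hV) (by positivity)
  calc |-((N : ℝ) ^ 2 * b) * ∑ μ : Fin d, ∑ ν : Fin d,
          (if μ = ν then (0 : ℝ) else -(1 / (2 * (N : ℝ))) * algD V (algD V (ekPlaq μ ν)) (emb g))|
      = (N : ℝ) ^ 2 * |b| * |∑ μ : Fin d, ∑ ν : Fin d,
          (if μ = ν then (0 : ℝ) else -(1 / (2 * (N : ℝ))) * algD V (algD V (ekPlaq μ ν)) (emb g))| := by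
        rw [abs_mul, abs_neg, abs_mul, abs_of_nonneg (by positivity : (0 : ℝ) ≤ (N : ℝ) ^ 2)]
    _ ≤ (N : ℝ) ^ 2 * |b| * ∑ μ : Fin d, ∑ ν : Fin d,
          (1 / (2 * (N : ℝ))) * (if μ = ν then (0 : ℝ) else 8 * (frobNorm (V μ) ^ 2 + frobNorm (V ν) ^ 2)) := by
        refine mul_le_mul_of_nonneg_left ?_ (by positivity)
        refine (Finset.abs_sum_le_sum_abs _ _).trans (Finset.sum_le_sum fun μ _ => ?_)
        exact (Finset.abs_sum_le_sum_abs _ _).trans (Finset.sum_le_sum fun ν _ => hterm μ ν)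
    _ = (N : ℝ) ^ 2 * |b| * ((1 / (2 * (N : ℝ))) * (8 * ∑ μ : Fin d, ∑ ν : Fin d,
          (if μ = ν then (0 : ℝ) else frobNorm (V μ) ^ 2 + frobNorm (V ν) ^ 2))) := by
        congr 1
        simp only [Finset.mul_sum]
        refine Finset.sum_congr rfl fun μ _ => Finset.sum_congr rfl fun ν _ => ?_
        split_ifs <;> ring
    _ = 8 * ((d : ℝ) - 1) * N * |b| * ∑ e, frobNorm (V e) ^ 2 := by
        rw [sum_sum_ite_add]
        have hN' : (N : ℝ) ≠ 0 := ne_of_gt hNr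
        field_simp

/-- The Bakry–Émery constant of the Eguchi–Kawai potential: `N/2 - 8(d-1)N|b| = (N/2)(1 - 16(d-1)|b|)`,
positive for every `N ≥ 1` as soon as `16(d-1)|b| < 1`. -/
theorem ekCurvature_pos (hN : N ≠ 0) {b : ℝ} (hb : 16 * ((d : ℝ) - 1) * |b| < 1) :
    0 < (N : ℝ) / 2 - 8 * ((d : ℝ) - 1) * N * |b| := by
  have hNr : (0 : ℝ) < N := by exact_mod_cast Nat.pos_of_ne_zero hN
  nlinarith

/-! ## The Poincaré inequality of the `SU(N)` Eguchi–Kawai model at strong coupling -/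

/-- **Bakry–Émery Poincaré inequality for the `SU(N)` Eguchi–Kawai model at strong coupling — real part
of the open line.** For every `d`, every `N ≥ 1`, every direction `μ` and every inverse 't Hooft
coupling `b` with `16(d-1)|b| < 1`:
`(N/2 - 8(d-1)N|b|) · ∫ w · (Re((1/N) tr V_μ) - m)² ≤ (1/N) · ∫ w` over `∏_μ dV_μ` (Haar on `SU(N)^d`),
where `w = e^{-N² b S_R}` is the Eguchi–Kawai weight and `m` the `w`-mean of `Re((1/N) tr V_μ)` —
`Summit.Ventures.YMGap.LatticeBakryEmery.poincare_gibbs_lipschitz` (Bakry–Émery `CD(N/2 - Λ, ∞)`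
on `SU(N)^d`, `Ric = N/2` per link, `Λ = 8(d-1)N|b|` from `hessBound_ekPot`) for the `1/√N`-Lipschitz
observable. -/
theorem ek_poincare_re (hN : N ≠ 0) {b : ℝ} (hb : 16 * ((d : ℝ) - 1) * |b| < 1) (μ : Fin d) :
    ((N : ℝ) / 2 - 8 * ((d : ℝ) - 1) * N * |b|) *
        ∫ V : EKConfigSU d N, ekWeight N b (inclSU V) * ((openLine μ (inclSU V)).re -
          (∫ V : EKConfigSU d N, ekWeight N b (inclSU V) * (openLine μ (inclSU V)).re ∂(ekHaarSU d N)) /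
            (∫ V : EKConfigSU d N, ekWeight N b (inclSU V) ∂(ekHaarSU d N))) ^ 2 ∂(ekHaarSU d N) ≤
      (1 / (N : ℝ)) * ∫ V : EKConfigSU d N, ekWeight N b (inclSU V) ∂(ekHaarSU d N) := by
  have h := poincare_gibbs_lipschitz hN (ekPot_mem_polySpace b) (hessBound_ekPot hN b) (ekCurvature_pos hN hb)
    (contDiff_ekReLink μ) (L := fun e => if e = μ then 1 / Real.sqrt N else 0)
    (fun e => by split_ifs <;> positivity) (linkLipschitz_ekReLink μ)
  simp only [exp_ekPot_emb, ekReLink_emb, sum_sq_linkLip μ, haarPi_eq_ekHaarSU] at h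
  exact h

/-- **Bakry–Émery Poincaré inequality for the `SU(N)` Eguchi–Kawai model at strong coupling —
imaginary part of the open line** (as `ek_poincare_re`). -/
theorem ek_poincare_im (hN : N ≠ 0) {b : ℝ} (hb : 16 * ((d : ℝ) - 1) * |b| < 1) (μ : Fin d) :
    ((N : ℝ) / 2 - 8 * ((d : ℝ) - 1) * N * |b|) *
        ∫ V : EKConfigSU d N, ekWeight N b (inclSU V) * ((openLine μ (inclSU V)).im -
          (∫ V : EKConfigSU d N, ekWeight N b (inclSU V) * (openLine μ (inclSU V)).im ∂(ekHaarSU d N)) /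
            (∫ V : EKConfigSU d N, ekWeight N b (inclSU V) ∂(ekHaarSU d N))) ^ 2 ∂(ekHaarSU d N) ≤
      (1 / (N : ℝ)) * ∫ V : EKConfigSU d N, ekWeight N b (inclSU V) ∂(ekHaarSU d N) := by
  have h := poincare_gibbs_lipschitz hN (ekPot_mem_polySpace b) (hessBound_ekPot hN b) (ekCurvature_pos hN hb)
    (contDiff_ekImLink μ) (L := fun e => if e = μ then 1 / Real.sqrt N else 0)
    (fun e => by split_ifs <;> positivity) (linkLipschitz_ekImLink μ)
  simp only [exp_ekPot_emb, ekImLink_emb, sum_sq_linkLip μ, haarPi_eq_ekHaarSU] at h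
  exact h

end Summit.QuantumFields.YangMills.Theorems.EguchiKawaiDirectionLadder
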